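import Literature.MathematicalPhysics.QuantumFieldTheory.ConformalBootstrap3D.BlockSatisfiabilityIff
import Literature.MathematicalPhysics.QuantumFieldTheory.ConformalBootstrap3D.FreeScalarBlockDecomposition
import Mathlib.Tactic
import HarnessLib

/-!
# The generic block clause is NOT uniquely solvable exactly on the exceptional set

Why the typed block predicate `IsConformalBlock3D` of `SigmaEpsilonSystem` switches to a LIMIT clause at the
unitarity bound `Δ = ℓ+1` and on the accidental-degeneracy set (`accidentalDegeneracy3D`; pub-ising3d REFEREE
F20, F23): at those points the GENERIC clause `IsConformalBlock3DAbove` — symmetric absolutely convergent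
`z`-double series with the Dolan–Osborn boundary row, solving the quadratic Casimir equation on `(0,1)²` — is
solvable but NOT uniquely. The docstring of `IsConformalBlock3DAbove` asserts this ("AT the bound the
predicate is degenerate … the conserved-current block is determined only up to the admixture of
`(z z̄) g_{Δ+1,ℓ-1}`"; accidental points: "`g_{Δ,ℓ} + C (z z̄)^{(n+ℓ-j)/2} g_{Δ+n,j}` also satisfies
(i)–(iii) for every `C`"), and the referee exhibited exact second solutions numerically
(`(11/2,4)+(15/2,0)`, `(7,3)+(8,0)`, pub-ising3d `code/check_block_predicate_B.py`). This file PROVES it,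
and with the uniqueness theorem at regular points (`IsConformalBlock3DAbove.eqOn_of_isRegular`,
`BlockCoefficientExtraction`) characterises the exceptional set as exactly the non-uniqueness locus:

* `IsConformalBlock3DAbove.add_smul_of_eigenvalue_eq` — if `g₁` is a generic `(Δ, ℓ)` block and `g₂` a
  generic `(Δ', ℓ')` block with the SAME Casimir eigenvalue and twist `Δ' - ℓ' = Δ - ℓ + 2m`, `m ≥ 1`, then
  `g₁ + C·g₂` is again a generic `(Δ, ℓ)` block, for every `C` and all `(Δ₁₂, Δ₃₄)` (the predicate's data are
  linear: `SatisfiesCoeffCasimir.add_smul`, `IsDoublePowerSeriesOn.add_smul`, `IsDoublePowerSeriesOn.shift`;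
  the Casimir PDE sees `(Δ, ℓ)` only through the eigenvalue, `casimirEq3D_iff_of_eigenvalue_eq`; the shifted
  series has no pure-`z` monomials, so the boundary row is untouched);
* `isConformalBlock3DAbove_add_smul_of_pivot_zero` — at an accidental degeneracy `(Δ, ℓ)`, witness `(n, j)`
  (`casimirPivot3D Δ ℓ n j = 0`), `hrBlockAB Δ₁₂ Δ₃₄ Δ ℓ + C · hrBlockAB Δ₁₂ Δ₃₄ (Δ+n) j` satisfies
  `IsConformalBlock3DAbove Δ₁₂ Δ₃₄ Δ ℓ` for every `C`; `not_eqOn_above_of_accidental` (two solutions that differ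
  on the square);
* `IsAdmissible3D.isConformalBlock3DAbove_hrBlock` — the generic clause is solvable at EVERY admissible point
  for equal external dimensions, the bound `Δ = ℓ+1` included (`hrBlock (ℓ+1) ℓ`: its coefficient system holds
  at the bound by continuity in `Δ`, `IsAdmissible3D.satisfiesCoeffCasimir_hrMonomialCoeff`; its series
  converges by the bounded single-trajectory coefficients of `FreeScalarBlockDecomposition`);
  `isConformalBlock3DAbove_bound_add_smul` — `hrBlock (ℓ+1) ℓ + C · hrBlock (ℓ+2) (ℓ-1)` is ALSO a generic
  `(ℓ+1, ℓ)` block (`ℓ ≥ 1`; `C_{ℓ+2,ℓ-1} = C_{ℓ+1,ℓ} = (ℓ-1)(ℓ+1)`); `not_eqOn_above_bound`;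
* `IsAdmissible3D.eqOn_above_iff_isRegularPoint3D` — for equal external dimensions at an admissible point:
  (all solutions of the generic clause agree on the square) ↔ `IsRegularPoint3D Δ₀ ℓ`;
  `eqOn_above_iff_not_accidental` — for all `(Δ₁₂, Δ₃₄)` strictly above the bound: (…agree…) ↔
  `¬ accidentalDegeneracy3D Δ₀ ℓ`.
So Definition (block) of the paper uses the limit clause at precisely the points where the generic clause
would not pin the block — no more, no fewer (above the relevant unitarity bound).

References: M. Hogervorst, S. Rychkov, Phys. Rev. D 87 (2013) 106004 [arXiv:1303.1111], §2.2 after eq. (2.27)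
(zero pivots of the recursion; the conserved-current admixture) [cite: HogervorstRychkov2013, §2.2 eq. (2.27)];
F. Kos, D. Poland, D. Simmons-Duffin, JHEP 11 (2014) 109 [arXiv:1406.4858], §4 (blocks at special `Δ` by
continuation) [cite: KosPolandSimmonsduffin2014, §4 eqs. (4.2)–(4.3)]; F. A. Dolan, H. Osborn, arXiv:1108.6194,
§2 eqs. (2.9)–(2.12) [cite: DolanOsborn2011, §2 eqs. (2.9)–(2.12)]. The linear-algebra argument is ours
(elementary). No new hypothesis-style fact is introduced.
-/

namespace Literature.MathematicalPhysics.QuantumFieldTheory.ConformalBootstrap3D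

open Set Filter Topology Finset

/-! ### 1. Linear structure of the data of the generic clause -/

/-- The five-term coefficient expression is linear in the array. [cite: DolanOsborn2011, §2 eqs. (2.10)–(2.12)] -/
theorem coeffCasimirLHS_add_smul (a b Δ : ℝ) (ℓ : ℕ) (k₁ k₂ : ℕ × ℕ → ℝ) (C : ℝ) (P Q : ℕ) :
    coeffCasimirLHS a b Δ ℓ (fun p => k₁ p + C * k₂ p) P Q =
      coeffCasimirLHS a b Δ ℓ k₁ P Q + C * coeffCasimirLHS a b Δ ℓ k₂ P Q := by
  unfold coeffCasimirLHS
  split_ifs <;> ring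

/-- Solutions of the coefficient Casimir system form a linear space. [cite: DolanOsborn2011, §2 eqs. (2.10)–(2.12)] -/
theorem SatisfiesCoeffCasimir.add_smul {a b Δ : ℝ} {ℓ : ℕ} {k₁ k₂ : ℕ × ℕ → ℝ}
    (h₁ : SatisfiesCoeffCasimir a b Δ ℓ k₁) (h₂ : SatisfiesCoeffCasimir a b Δ ℓ k₂) (C : ℝ) :
    SatisfiesCoeffCasimir a b Δ ℓ (fun p => k₁ p + C * k₂ p) := fun P Q => by
  rw [coeffCasimirLHS_add_smul, h₁ P Q, h₂ P Q, mul_zero, add_zero]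

/-- Linear combinations of absolutely convergent double power series. [folklore] -/
theorem IsDoublePowerSeriesOn.add_smul {k₁ k₂ : ℕ × ℕ → ℝ} {K₁ K₂ : ℝ → ℝ → ℝ}
    (h₁ : IsDoublePowerSeriesOn k₁ K₁) (h₂ : IsDoublePowerSeriesOn k₂ K₂) (C : ℝ) :
    IsDoublePowerSeriesOn (fun p => k₁ p + C * k₂ p) (fun z zb => K₁ z zb + C * K₂ z zb) := by
  intro z zb hz hzb
  obtain ⟨hs₁, he₁⟩ := h₁ z zb hz hzb
  obtain ⟨hs₂, he₂⟩ := h₂ z zb hz hzb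
  refine ⟨?_, ?_⟩
  · refine (hs₁.add (hs₂.mul_left |C|)).of_nonneg_of_le (fun p => by positivity) (fun p => ?_)
    have hle : |k₁ p + C * k₂ p| ≤ |k₁ p| + |C| * |k₂ p| := by
      calc |k₁ p + C * k₂ p| ≤ |k₁ p| + |C * k₂ p| := abs_add_le _ _
        _ = |k₁ p| + |C| * |k₂ p| := by rw [abs_mul]
    have hzp : 0 ≤ |z| ^ p.1 * |zb| ^ p.2 := by positivity
    calc |k₁ p + C * k₂ p| * |z| ^ p.1 * |zb| ^ p.2
        = |k₁ p + C * k₂ p| * (|z| ^ p.1 * |zb| ^ p.2) := by ring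
      _ ≤ (|k₁ p| + |C| * |k₂ p|) * (|z| ^ p.1 * |zb| ^ p.2) := mul_le_mul_of_nonneg_right hle hzp
      _ = |k₁ p| * |z| ^ p.1 * |zb| ^ p.2 + |C| * (|k₂ p| * |z| ^ p.1 * |zb| ^ p.2) := by ring
  · have hs₁' : Summable fun p : ℕ × ℕ => k₁ p * z ^ p.1 * zb ^ p.2 :=
      hs₁.of_norm_bounded fun p => by rw [Real.norm_eq_abs, abs_mul, abs_mul, abs_pow, abs_pow]
    have hs₂' : Summable fun p : ℕ × ℕ => k₂ p * z ^ p.1 * zb ^ p.2 :=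
      hs₂.of_norm_bounded fun p => by rw [Real.norm_eq_abs, abs_mul, abs_mul, abs_pow, abs_pow]
    have H := hs₁'.hasSum.add (hs₂'.hasSum.mul_left C)
    simp only
    rw [he₁, he₂, ← H.tsum_eq]
    exact tsum_congr fun p => by ring

/-- Multiplying a double power series by `(z z̄)^m` shifts its coefficient array by `(m, m)` (and kills
every pure-`z` and pure-`z̄` monomial when `m ≥ 1`). [folklore] -/
theorem IsDoublePowerSeriesOn.shift {k : ℕ × ℕ → ℝ} {K : ℝ → ℝ → ℝ} (h : IsDoublePowerSeriesOn k K)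
    (m : ℕ) :
    IsDoublePowerSeriesOn (fun q : ℕ × ℕ => if m ≤ q.1 ∧ m ≤ q.2 then k (q.1 - m, q.2 - m) else 0)
      (fun z zb => (z * zb) ^ m * K z zb) := by
  intro z zb hz hzb
  obtain ⟨hs, he⟩ := h z zb hz hzb
  have hinj := shift_injective m m
  have hoff : ∀ q : ℕ × ℕ, q ∉ Set.range (fun p : ℕ × ℕ => (p.1 + m, p.2 + m)) →
      ¬ (m ≤ q.1 ∧ m ≤ q.2) := fun q hq hh =>
    hq ⟨(q.1 - m, q.2 - m), by ext <;> simp <;> omega⟩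
  refine ⟨?_, ?_⟩
  · have hs' : Summable (fun p : ℕ × ℕ => |k p| * |z| ^ (p.1 + m) * |zb| ^ (p.2 + m)) :=
      (hs.mul_left ((|z| * |zb|) ^ m)).congr fun p => by rw [mul_pow]; ring
    refine (hinj.summable_iff (fun q hq => ?_)).mp ?_
    · show |(if m ≤ q.1 ∧ m ≤ q.2 then k (q.1 - m, q.2 - m) else 0)| * |z| ^ q.1 * |zb| ^ q.2 = 0
      rw [if_neg (hoff q hq), abs_zero, zero_mul, zero_mul]
    · refine hs'.congr fun p => ?_
      simp only [Function.comp_apply, Nat.add_sub_cancel]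
      rw [if_pos ⟨Nat.le_add_left m p.1, Nat.le_add_left m p.2⟩]
  · have hsigned : Summable fun p : ℕ × ℕ => k p * z ^ p.1 * zb ^ p.2 :=
      hs.of_norm_bounded fun p => by rw [Real.norm_eq_abs, abs_mul, abs_mul, abs_pow, abs_pow]
    have H1 : HasSum (fun p : ℕ × ℕ => k p * z ^ (p.1 + m) * zb ^ (p.2 + m)) ((z * zb) ^ m * K z zb) := by
      rw [he]
      refine (hsigned.hasSum.mul_left ((z * zb) ^ m)).congr_fun fun p => ?_
      rw [mul_pow]; ring
    have H2 := hasSum_shift (i := m) (j := m)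
      (G := fun q : ℕ × ℕ => k (q.1 - m, q.2 - m) * z ^ q.1 * zb ^ q.2)
      (by simpa only [Nat.add_sub_cancel] using H1)
    simp only
    rw [← H2.tsum_eq]
    refine tsum_congr fun q => ?_
    split_ifs <;> simp

/-- The Casimir PDE sees `(Δ, ℓ)` only through the eigenvalue: two parameter pairs with the same
`casimirEigenvalue3D` have the same equation. [cite: DolanOsborn2011, §2 eq. (2.12)] -/
theorem casimirEq3D_iff_of_eigenvalue_eq {Δ₁₂ Δ₃₄ Δ Δ' : ℝ} {ℓ ℓ' : ℕ} {g : ℝ → ℝ → ℝ} {z zb : ℝ}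
    (h : casimirEigenvalue3D Δ' ℓ' = casimirEigenvalue3D Δ ℓ) :
    CasimirEq3D Δ₁₂ Δ₃₄ Δ' ℓ' g z zb ↔ CasimirEq3D Δ₁₂ Δ₃₄ Δ ℓ g z zb := by
  unfold CasimirEq3D
  rw [h]

/-- **Data of a generic block, re-based to a smaller twist exponent.** If `g'` satisfies the generic clause
for `(Δ', ℓ')` and `Δ' - ℓ' = Δ - ℓ + 2m` with `m ≥ 1`, then on the square
`g' = (z z̄)^{(Δ-ℓ)/2} K'` with `K' = (z z̄)^m K` an absolutely convergent symmetric double series WITHOUT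
pure-`z` monomials. [cite: DolanOsborn2011, §2 eq. (2.9)] -/
theorem IsConformalBlock3DAbove.exists_shifted_coeff {Δ₁₂ Δ₃₄ Δ' : ℝ} {ℓ' : ℕ} {g' : ℝ → ℝ → ℝ}
    (h : IsConformalBlock3DAbove Δ₁₂ Δ₃₄ Δ' ℓ' g') {Δ : ℝ} {ℓ m : ℕ} (hm : 1 ≤ m)
    (htw : Δ' - (ℓ' : ℝ) = Δ - (ℓ : ℝ) + 2 * (m : ℝ)) :
    ∃ (k' : ℕ × ℕ → ℝ) (K' : ℝ → ℝ → ℝ), IsDoublePowerSeriesOn k' K' ∧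
      (∀ p : ℕ × ℕ, k' (p.2, p.1) = k' p) ∧ (∀ i : ℕ, k' (i, 0) = 0) ∧
      (∀ z zb : ℝ, z ∈ Ioo (0 : ℝ) 1 → zb ∈ Ioo (0 : ℝ) 1 →
        g' z zb = (z * zb) ^ ((Δ - (ℓ : ℝ)) / 2) * K' z zb) ∧
      ∀ z zb : ℝ, z ∈ Ioo (0 : ℝ) 1 → zb ∈ Ioo (0 : ℝ) 1 → CasimirEq3D Δ₁₂ Δ₃₄ Δ' ℓ' g' z zb := by
  obtain ⟨k, K, hS, hsym, -, hg, hC⟩ := h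
  refine ⟨fun q => if m ≤ q.1 ∧ m ≤ q.2 then k (q.1 - m, q.2 - m) else 0,
    fun z zb => (z * zb) ^ m * K z zb, hS.shift m, fun p => ?_, fun i => ?_, fun z zb hz hzb => ?_, hC⟩
  · simp only
    by_cases hq : m ≤ p.1 ∧ m ≤ p.2
    · rw [if_pos ⟨hq.2, hq.1⟩, if_pos hq]
      exact hsym (p.1 - m, p.2 - m)
    · have hq' : ¬ (m ≤ p.2 ∧ m ≤ p.1) := fun hh => hq ⟨hh.2, hh.1⟩
      rw [if_neg hq', if_neg hq]
  · simp only
    rw [if_neg]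
    omega
  · rw [hg z zb hz hzb]
    have hxy : 0 < z * zb := mul_pos hz.1 hzb.1
    have hexp : (Δ' - (ℓ' : ℝ)) / 2 = (Δ - (ℓ : ℝ)) / 2 + (m : ℝ) := by rw [htw]; ring
    rw [hexp, Real.rpow_add hxy, Real.rpow_natCast]
    ring

/-- **Superposition of generic blocks with equal Casimir eigenvalue.** If `g₁` satisfies the generic clause for
`(Δ, ℓ)` and `g₂` for `(Δ', ℓ')`, with `casimirEigenvalue3D Δ' ℓ' = casimirEigenvalue3D Δ ℓ` and
`Δ' - ℓ' = Δ - ℓ + 2m`, `m ≥ 1`, then `g₁ + C · g₂` satisfies the generic clause for `(Δ, ℓ)`, for every real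
`C` and all `(Δ₁₂, Δ₃₄)`: the coefficient system is linear, the PDE is shared, and the shifted series of `g₂`
contributes no pure-`z` monomial, so the Dolan–Osborn boundary row of `g₁` is untouched.
[cite: HogervorstRychkov2013, §2.2 eq. (2.27)] -/
theorem IsConformalBlock3DAbove.add_smul_of_eigenvalue_eq {Δ₁₂ Δ₃₄ Δ Δ' : ℝ} {ℓ ℓ' : ℕ}
    {g₁ g₂ : ℝ → ℝ → ℝ} (h₁ : IsConformalBlock3DAbove Δ₁₂ Δ₃₄ Δ ℓ g₁)
    (h₂ : IsConformalBlock3DAbove Δ₁₂ Δ₃₄ Δ' ℓ' g₂)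
    (heig : casimirEigenvalue3D Δ' ℓ' = casimirEigenvalue3D Δ ℓ) {m : ℕ} (hm : 1 ≤ m)
    (htw : Δ' - (ℓ' : ℝ) = Δ - (ℓ : ℝ) + 2 * (m : ℝ)) (C : ℝ) :
    IsConformalBlock3DAbove Δ₁₂ Δ₃₄ Δ ℓ (fun z zb => g₁ z zb + C * g₂ z zb) := by
  obtain ⟨k₁, K₁, hS₁, hsym₁, hlead₁, hg₁, hC₁⟩ := h₁
  obtain ⟨k', K', hS', hsym', hpure', hg', hC'⟩ := h₂.exists_shifted_coeff hm htw
  have hk₁ : SatisfiesCoeffCasimir (-Δ₁₂ / 2) (Δ₃₄ / 2) Δ ℓ k₁ :=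
    satisfiesCoeffCasimir_of_casimirEq3D hS₁ hg₁ hC₁
  have hC₂ : ∀ z zb : ℝ, z ∈ Ioo (0 : ℝ) 1 → zb ∈ Ioo (0 : ℝ) 1 → CasimirEq3D Δ₁₂ Δ₃₄ Δ ℓ g₂ z zb :=
    fun z zb hz hzb => (casimirEq3D_iff_of_eigenvalue_eq heig).mp (hC' z zb hz hzb)
  have hk' : SatisfiesCoeffCasimir (-Δ₁₂ / 2) (Δ₃₄ / 2) Δ ℓ k' :=
    satisfiesCoeffCasimir_of_casimirEq3D hS' hg' hC₂
  have hSC := hS₁.add_smul hS' C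
  have hgC : ∀ z zb : ℝ, z ∈ Ioo (0 : ℝ) 1 → zb ∈ Ioo (0 : ℝ) 1 →
      g₁ z zb + C * g₂ z zb = (z * zb) ^ ((Δ - (ℓ : ℝ)) / 2) * (K₁ z zb + C * K' z zb) := by
    intro z zb hz hzb
    rw [hg₁ z zb hz hzb, hg' z zb hz hzb]
    ring
  refine ⟨fun p => k₁ p + C * k' p, fun z zb => K₁ z zb + C * K' z zb, hSC, fun p => ?_, ⟨?_, ?_⟩,
    hgC, ?_⟩
  · simp only
    rw [hsym₁ p, hsym' p]
  · intro i hi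
    simp only
    rw [hlead₁.1 i hi, hpure' i, mul_zero, add_zero]
  · simp only
    rw [hlead₁.2, hpure' ℓ, mul_zero, add_zero]
  · exact casimirEq3D_of_satisfiesCoeffCasimir hSC hgC (hk₁.add_smul hk' C)

/-! ### 2. Accidental degeneracies: a second generic solution, all external dimensions -/

/-- At an accidental degeneracy above the bound, the witness `(n, j)` is an unreachable seed: `j + n < ℓ`.
[cite: HogervorstRychkov2013, §3 eq. (3.5)] -/
theorem lt_of_pivot_zero {Δ : ℝ} {ℓ n j : ℕ} (hΔ : unitarityBound3D ℓ < Δ) (hn : 1 ≤ n)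
    (hj : j ≤ ℓ + n) (hpar : (j + ℓ + n) % 2 = 0) (hpiv : casimirPivot3D Δ ℓ n j = 0) : j + n < ℓ := by
  by_contra hge
  have hjl : ℓ ≤ j + n := by omega
  have := casimirPivot3D_pos hΔ hn hjl hj hpar
  linarith

/-- At an accidental degeneracy above the bound with witness `(n, j)`, the partner point `(Δ+n, j)` lies
strictly above ITS unitarity bound (so `hrBlockAB … (Δ+n) j` is a generic block). [folklore] -/
theorem bound_lt_add_of_pivot_zero {Δ : ℝ} {ℓ n j : ℕ} (hΔ : unitarityBound3D ℓ < Δ) (hn : 1 ≤ n)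
    (hj : j ≤ ℓ + n) (hpar : (j + ℓ + n) % 2 = 0) (hpiv : casimirPivot3D Δ ℓ n j = 0) :
    unitarityBound3D j < Δ + (n : ℝ) := by
  have hlt := lt_of_pivot_zero hΔ hn hj hpar hpiv
  have hhalf : 1 / 2 < Δ := one_half_lt_of_unitarityBound3D_lt hΔ
  have hn0 : (0 : ℝ) ≤ n := Nat.cast_nonneg n
  unfold unitarityBound3D at hΔ ⊢
  by_cases hj0 : j = 0
  · rw [if_pos hj0]; linarith
  · rw [if_neg hj0]
    have hℓ0 : ℓ ≠ 0 := by omega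
    rw [if_neg hℓ0] at hΔ
    have : (j : ℝ) + 1 ≤ (ℓ : ℝ) := by exact_mod_cast (show j + 1 ≤ ℓ by omega)
    linarith

/-- **Second solution at an accidental degeneracy.** If `casimirPivot3D Δ ℓ n j = 0` with `n ≥ 1`,
`j ≤ ℓ+n`, `j ≡ ℓ+n (mod 2)`, `Δ` above the bound, then for every `C` and all `(Δ₁₂, Δ₃₄)` the function
`hrBlockAB Δ₁₂ Δ₃₄ Δ ℓ + C · hrBlockAB Δ₁₂ Δ₃₄ (Δ+n) j` satisfies `IsConformalBlock3DAbove Δ₁₂ Δ₃₄ Δ ℓ` — the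
exact non-uniqueness witnesses of pub-ising3d REFEREE F20 (`(7,3)+(8,0)`, `(11/2,4)+(15/2,0)`, …) as a theorem.
[cite: HogervorstRychkov2013, §2.2 eq. (2.27)] -/
theorem isConformalBlock3DAbove_add_smul_of_pivot_zero (Δ₁₂ Δ₃₄ : ℝ) {Δ : ℝ} {ℓ n j : ℕ}
    (hΔ : unitarityBound3D ℓ < Δ) (hn : 1 ≤ n) (hj : j ≤ ℓ + n) (hpar : (j + ℓ + n) % 2 = 0)
    (hpiv : casimirPivot3D Δ ℓ n j = 0) (C : ℝ) :
    IsConformalBlock3DAbove Δ₁₂ Δ₃₄ Δ ℓ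
      (fun z zb => hrBlockAB Δ₁₂ Δ₃₄ Δ ℓ z zb + C * hrBlockAB Δ₁₂ Δ₃₄ (Δ + (n : ℝ)) j z zb) := by
  have hlt := lt_of_pivot_zero hΔ hn hj hpar hpiv
  have hΔ' := bound_lt_add_of_pivot_zero hΔ hn hj hpar hpiv
  have heig : casimirEigenvalue3D (Δ + (n : ℝ)) j = casimirEigenvalue3D Δ ℓ := by
    have h := casimirPivot3D_eq Δ ℓ n j
    rw [hpiv] at h
    linarith
  -- the twist offset `m = (ℓ + n - j)/2 ≥ 1`
  obtain ⟨m, hm⟩ : ∃ m : ℕ, ℓ + n - j = 2 * m := ⟨(ℓ + n - j) / 2, by omega⟩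
  have hm1 : 1 ≤ m := by omega
  have htw : Δ + (n : ℝ) - (j : ℝ) = Δ - (ℓ : ℝ) + 2 * (m : ℝ) := by
    have h1 : ((ℓ + n - j : ℕ) : ℝ) = 2 * (m : ℝ) := by exact_mod_cast hm
    rw [Nat.cast_sub (by omega), Nat.cast_add] at h1
    linarith
  exact (isConformalBlock3DAbove_hrBlockAB hΔ).add_smul_of_eigenvalue_eq
    (isConformalBlock3DAbove_hrBlockAB hΔ') heig hm1 htw C

/-- **Non-uniqueness of the generic clause at an accidental degeneracy** (all external dimensions): two
functions satisfying `IsConformalBlock3DAbove Δ₁₂ Δ₃₄ Δ ℓ` that differ somewhere on the open square.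
[cite: HogervorstRychkov2013, §2.2 eq. (2.27)] -/
theorem not_eqOn_above_of_accidental (Δ₁₂ Δ₃₄ : ℝ) {Δ : ℝ} {ℓ : ℕ} (hΔ : unitarityBound3D ℓ < Δ)
    (hacc : accidentalDegeneracy3D Δ ℓ) :
    ∃ g₁ g₂ : ℝ → ℝ → ℝ, IsConformalBlock3DAbove Δ₁₂ Δ₃₄ Δ ℓ g₁ ∧ IsConformalBlock3DAbove Δ₁₂ Δ₃₄ Δ ℓ g₂ ∧
      ∃ z zb : ℝ, z ∈ Ioo (0 : ℝ) 1 ∧ zb ∈ Ioo (0 : ℝ) 1 ∧ g₁ z zb ≠ g₂ z zb := by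
  obtain ⟨n, j, hn, hj, hpar, hpiv⟩ := (accidentalDegeneracy3D_iff Δ ℓ).mp hacc
  have hΔ' := bound_lt_add_of_pivot_zero hΔ hn hj hpar hpiv
  obtain ⟨z, zb, hz, hzb, hne⟩ := exists_hrBlockAB_ne_zero Δ₁₂ Δ₃₄ hΔ'
  refine ⟨hrBlockAB Δ₁₂ Δ₃₄ Δ ℓ,
    fun z zb => hrBlockAB Δ₁₂ Δ₃₄ Δ ℓ z zb + 1 * hrBlockAB Δ₁₂ Δ₃₄ (Δ + (n : ℝ)) j z zb,
    isConformalBlock3DAbove_hrBlockAB hΔ,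
    isConformalBlock3DAbove_add_smul_of_pivot_zero Δ₁₂ Δ₃₄ hΔ hn hj hpar hpiv 1, z, zb, hz, hzb, ?_⟩
  intro h
  apply hne
  linarith

/-- **Characterisation strictly above the bound, all external dimensions**: all solutions of the generic
clause agree on the open square iff the point is not an accidental degeneracy.
[cite: HogervorstRychkov2013, §2.2 eq. (2.27)] -/
theorem eqOn_above_iff_not_accidental (Δ₁₂ Δ₃₄ : ℝ) {Δ : ℝ} {ℓ : ℕ} (hΔ : unitarityBound3D ℓ < Δ) :
    (∀ g₁ g₂ : ℝ → ℝ → ℝ, IsConformalBlock3DAbove Δ₁₂ Δ₃₄ Δ ℓ g₁ → IsConformalBlock3DAbove Δ₁₂ Δ₃₄ Δ ℓ g₂ →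
        ∀ z zb : ℝ, z ∈ Ioo (0 : ℝ) 1 → zb ∈ Ioo (0 : ℝ) 1 → g₁ z zb = g₂ z zb) ↔
      ¬ accidentalDegeneracy3D Δ ℓ := by
  constructor
  · intro huniq hacc
    obtain ⟨g₁, g₂, h₁, h₂, z, zb, hz, hzb, hne⟩ := not_eqOn_above_of_accidental Δ₁₂ Δ₃₄ hΔ hacc
    exact hne (huniq g₁ g₂ h₁ h₂ z zb hz hzb)
  · intro hreg g₁ g₂ h₁ h₂
    exact h₁.eqOn_of_isRegular hΔ hreg h₂

/-! ### 3. The unitarity bound: the generic clause holds for `hrBlock (ℓ+1) ℓ`, and not uniquely -/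

/-- Continuity in `Δ` of the five-term coefficient expression along a `Δ`-dependent array that is continuous
entrywise (the weights are polynomials in `Δ`). [cite: DolanOsborn2011, §2 eqs. (2.10)–(2.12)] -/
theorem continuousAt_coeffCasimirLHS {a b : ℝ} {ℓ : ℕ} {kf : ℝ → ℕ × ℕ → ℝ} {Δ₀ : ℝ}
    (hk : ∀ p, ContinuousAt (fun Δ => kf Δ p) Δ₀) (P Q : ℕ) :
    ContinuousAt (fun Δ => coeffCasimirLHS a b Δ ℓ (kf Δ) P Q) Δ₀ := by
  have cA : ∀ m n : ℕ, ContinuousAt (fun Δ => coeffA Δ ℓ m n) Δ₀ := fun m n => by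
    unfold coeffA halfTwist casimirEigenvalue3D; fun_prop
  have cB : ∀ m n : ℕ, ContinuousAt (fun Δ => coeffB Δ ℓ m n) Δ₀ := fun m n => by
    unfold coeffB halfTwist casimirEigenvalue3D; fun_prop
  have cC : ∀ m : ℕ, ContinuousAt (fun Δ => coeffC a b Δ ℓ m) Δ₀ := fun m => by
    unfold coeffC halfTwist; fun_prop
  have cD : ∀ m n : ℕ, ContinuousAt (fun Δ => coeffD a b Δ ℓ m n) Δ₀ := fun m n => by
    unfold coeffD halfTwist; fun_prop
  have cE : ∀ n : ℕ, ContinuousAt (fun Δ => coeffE a b Δ ℓ n) Δ₀ := fun n => by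
    unfold coeffE halfTwist; fun_prop
  have t1 : ContinuousAt (fun Δ => if 1 ≤ P then coeffA Δ ℓ (P - 1) Q * kf Δ (P - 1, Q) else 0) Δ₀ := by
    by_cases h : 1 ≤ P
    · simp only [if_pos h]; exact (cA _ _).mul (hk _)
    · simp only [if_neg h]; exact continuousAt_const
  have t2 : ContinuousAt (fun Δ => if 1 ≤ Q then coeffB Δ ℓ P (Q - 1) * kf Δ (P, Q - 1) else 0) Δ₀ := by
    by_cases h : 1 ≤ Q
    · simp only [if_pos h]; exact (cB _ _).mul (hk _)
    · simp only [if_neg h]; exact continuousAt_const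
  have t3 : ContinuousAt (fun Δ => if 2 ≤ P then coeffC a b Δ ℓ (P - 2) * kf Δ (P - 2, Q) else 0) Δ₀ := by
    by_cases h : 2 ≤ P
    · simp only [if_pos h]; exact (cC _).mul (hk _)
    · simp only [if_neg h]; exact continuousAt_const
  have t4 : ContinuousAt
      (fun Δ => if 1 ≤ P ∧ 1 ≤ Q then coeffD a b Δ ℓ (P - 1) (Q - 1) * kf Δ (P - 1, Q - 1) else 0) Δ₀ := by
    by_cases h : 1 ≤ P ∧ 1 ≤ Q
    · simp only [if_pos h]; exact (cD _ _).mul (hk _)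
    · simp only [if_neg h]; exact continuousAt_const
  have t5 : ContinuousAt (fun Δ => if 2 ≤ Q then coeffE a b Δ ℓ (Q - 2) * kf Δ (P, Q - 2) else 0) Δ₀ := by
    by_cases h : 2 ≤ Q
    · simp only [if_pos h]; exact (cE _).mul (hk _)
    · simp only [if_neg h]; exact continuousAt_const
  unfold coeffCasimirLHS
  exact (((t1.add t2).add t3).add t4).add t5

/-- **The coefficient Casimir system for `hrMonomialCoeff` at EVERY admissible point**, the unitarity bound
included: above the bound it is `hrMonomialCoeff_satisfies`; at the bound every equation is the limit
`Δ ↓ ℓ+1` of equations that hold, all ingredients being continuous in `Δ` there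
(`IsAdmissible3D.continuousAt_hrMonomialCoeff`). [cite: HogervorstRychkov2013, §2.2 eqs. (2.27), (2.30)] -/
theorem IsAdmissible3D.satisfiesCoeffCasimir_hrMonomialCoeff {Δ₀ : ℝ} {ℓ : ℕ} (hadm : IsAdmissible3D Δ₀ ℓ) :
    SatisfiesCoeffCasimir 0 0 Δ₀ ℓ (hrMonomialCoeff Δ₀ ℓ) := by
  intro P Q
  set f : ℝ → ℝ := fun Δ => coeffCasimirLHS 0 0 Δ ℓ (hrMonomialCoeff Δ ℓ) P Q with hf
  have hcont : ContinuousAt f Δ₀ :=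
    continuousAt_coeffCasimirLHS (kf := fun Δ => hrMonomialCoeff Δ ℓ) hadm.continuousAt_hrMonomialCoeff P Q
  have hzero : ∀ᶠ Δ in 𝓝[>] Δ₀, f Δ = 0 := by
    filter_upwards [self_mem_nhdsWithin] with Δ hΔ
    exact hrMonomialCoeff_satisfies (lt_of_le_of_lt hadm.1 hΔ) P Q
  have h1 : Tendsto f (𝓝[>] Δ₀) (𝓝 (f Δ₀)) := hcont.tendsto.mono_left nhdsWithin_le_nhds
  have h2 : Tendsto f (𝓝[>] Δ₀) (𝓝 0) :=
    (tendsto_const_nhds (x := (0 : ℝ))).congr' (hzero.mono fun Δ h => h.symm)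
  exact tendsto_nhds_unique h1 h2

/-- The typed clause `IsDoublePowerSeriesOn` for the HR array at EVERY admissible point (at the bound the
coefficients are bounded, `hrMonomialCoeff_bound_le`, so the series converges on the bidisk).
[cite: HogervorstRychkov2013, §2.1 eq. (2.16)] -/
theorem IsAdmissible3D.isDoublePowerSeriesOn_hrSeries {Δ₀ : ℝ} {ℓ : ℕ} (hadm : IsAdmissible3D Δ₀ ℓ) :
    IsDoublePowerSeriesOn (hrMonomialCoeff Δ₀ ℓ) (hrSeries Δ₀ ℓ) := by
  rcases (hadm.1).lt_or_eq with hlt | heq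
  · exact ConformalBootstrap3D.isDoublePowerSeriesOn_hrSeries hlt
  · have hℓ : 1 ≤ ℓ := by
      by_contra h0
      have h0' : ℓ = 0 := by omega
      exact absurd heq (hadm.2 h0').ne
    have hΔ : Δ₀ = (ℓ : ℝ) + 1 := by
      rw [← heq]; unfold unitarityBound3D; rw [if_neg (by omega)]
    subst hΔ
    intro z zb hz hzb
    refine ⟨?_, rfl⟩
    have hgeo : Summable fun p : ℕ × ℕ => |z| ^ p.1 * |zb| ^ p.2 :=
      (summable_geometric_of_lt_one (abs_nonneg z) hz).mul_of_nonneg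
        (summable_geometric_of_lt_one (abs_nonneg zb) hzb)
        (fun _ => pow_nonneg (abs_nonneg z) _) (fun _ => pow_nonneg (abs_nonneg zb) _)
    refine (hgeo.mul_left (4 ^ ℓ / legendreLam ℓ)).of_nonneg_of_le (fun p => by positivity) (fun p => ?_)
    rw [abs_of_nonneg (hrMonomialCoeff_bound_nonneg ℓ p), mul_assoc]
    exact mul_le_mul_of_nonneg_right (hrMonomialCoeff_bound_le ℓ p)
      (mul_nonneg (pow_nonneg (abs_nonneg z) _) (pow_nonneg (abs_nonneg zb) _))

/-- **The generic clause is solvable at EVERY admissible point** (equal external dimensions): `hrBlock Δ₀ ℓ`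
satisfies `IsConformalBlock3DAbove 0 0 Δ₀ ℓ` also AT the unitarity bound `Δ₀ = ℓ+1` (where the typed
predicate `IsConformalBlock3D` deliberately does not use this clause, because it is not uniquely solvable
there — `isConformalBlock3DAbove_bound_add_smul`). [cite: HogervorstRychkov2013, §2.2 eq. (2.30)] -/
theorem IsAdmissible3D.isConformalBlock3DAbove_hrBlock {Δ₀ : ℝ} {ℓ : ℕ} (hadm : IsAdmissible3D Δ₀ ℓ) :
    IsConformalBlock3DAbove 0 0 Δ₀ ℓ (hrBlock Δ₀ ℓ) := by
  refine ⟨hrMonomialCoeff Δ₀ ℓ, hrSeries Δ₀ ℓ, hadm.isDoublePowerSeriesOn_hrSeries,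
    hrMonomialCoeff_symm Δ₀ ℓ, hrMonomialCoeff_hasLeadingPart Δ₀ ℓ, fun z zb _ _ => rfl, ?_⟩
  have hk : SatisfiesCoeffCasimir (-(0 : ℝ) / 2) ((0 : ℝ) / 2) Δ₀ ℓ (hrMonomialCoeff Δ₀ ℓ) := by
    rw [neg_zero, zero_div]
    exact hadm.satisfiesCoeffCasimir_hrMonomialCoeff
  exact casimirEq3D_of_satisfiesCoeffCasimir hadm.isDoublePowerSeriesOn_hrSeries (fun z zb _ _ => rfl) hk

/-- The generic clause AT the bound: `IsConformalBlock3DAbove 0 0 (ℓ+1) ℓ (hrBlock (ℓ+1) ℓ)` for every `ℓ`.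
[cite: HogervorstRychkov2013, §2.2 eq. (2.30)] -/
theorem isConformalBlock3DAbove_hrBlock_bound (ℓ : ℕ) :
    IsConformalBlock3DAbove 0 0 ((ℓ : ℝ) + 1) ℓ (hrBlock ((ℓ : ℝ) + 1) ℓ) := by
  rcases Nat.eq_zero_or_pos ℓ with hℓ | hℓ
  · subst hℓ
    have hlt : unitarityBound3D 0 < ((0 : ℕ) : ℝ) + 1 := by
      simp [unitarityBound3D]; norm_num
    exact isConformalBlock3DAbove_hrBlock hlt
  · exact (isAdmissible3D_bound hℓ).isConformalBlock3DAbove_hrBlock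

/-- The conserved-current degeneracy: `C_{ℓ+2, ℓ-1} = C_{ℓ+1, ℓ}` (`= (ℓ-1)(ℓ+1)`), `ℓ ≥ 1`.
[cite: HogervorstRychkov2013, §2.2 eq. (2.30)] -/
theorem casimirEigenvalue3D_bound_partner {ℓ : ℕ} (hℓ : 1 ≤ ℓ) :
    casimirEigenvalue3D ((ℓ : ℝ) + 2) (ℓ - 1) = casimirEigenvalue3D ((ℓ : ℝ) + 1) ℓ := by
  unfold casimirEigenvalue3D
  rw [Nat.cast_sub hℓ]
  push_cast
  ring

/-- **Second generic solution at the unitarity bound.** For `ℓ ≥ 1` and every `C`, the function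
`hrBlock (ℓ+1) ℓ + C · hrBlock (ℓ+2) (ℓ-1)` satisfies `IsConformalBlock3DAbove 0 0 (ℓ+1) ℓ` — the admixture of
the null descendant's block (twist `3 = 1 + 2·1`, same Casimir eigenvalue) that makes the generic clause
degenerate at the bound, as asserted in the docstring of `IsConformalBlock3DAbove`.
[cite: HogervorstRychkov2013, §2.2 eq. (2.30)] -/
theorem isConformalBlock3DAbove_bound_add_smul {ℓ : ℕ} (hℓ : 1 ≤ ℓ) (C : ℝ) :
    IsConformalBlock3DAbove 0 0 ((ℓ : ℝ) + 1) ℓ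
      (fun z zb => hrBlock ((ℓ : ℝ) + 1) ℓ z zb + C * hrBlock ((ℓ : ℝ) + 2) (ℓ - 1) z zb) := by
  have hΔ' : unitarityBound3D (ℓ - 1) < (ℓ : ℝ) + 2 := by
    unfold unitarityBound3D
    split_ifs with h
    · have : (0 : ℝ) ≤ ℓ := Nat.cast_nonneg ℓ
      linarith
    · rw [Nat.cast_sub hℓ]; push_cast; linarith
  have htw : (ℓ : ℝ) + 2 - ((ℓ - 1 : ℕ) : ℝ) = (ℓ : ℝ) + 1 - (ℓ : ℝ) + 2 * ((1 : ℕ) : ℝ) := by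
    rw [Nat.cast_sub hℓ]; push_cast; ring
  exact (isConformalBlock3DAbove_hrBlock_bound ℓ).add_smul_of_eigenvalue_eq
    (isConformalBlock3DAbove_hrBlock hΔ') (casimirEigenvalue3D_bound_partner hℓ) le_rfl htw C

/-- **Non-uniqueness of the generic clause at the unitarity bound** (`ℓ ≥ 1`, equal external dimensions):
two solutions that differ somewhere on the square — the reason `IsConformalBlock3D` uses the limit clause
there. [cite: HogervorstRychkov2013, §2.2 eq. (2.30)] -/
theorem not_eqOn_above_bound {ℓ : ℕ} (hℓ : 1 ≤ ℓ) :
    ∃ g₁ g₂ : ℝ → ℝ → ℝ, IsConformalBlock3DAbove 0 0 ((ℓ : ℝ) + 1) ℓ g₁ ∧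
      IsConformalBlock3DAbove 0 0 ((ℓ : ℝ) + 1) ℓ g₂ ∧
      ∃ z zb : ℝ, z ∈ Ioo (0 : ℝ) 1 ∧ zb ∈ Ioo (0 : ℝ) 1 ∧ g₁ z zb ≠ g₂ z zb := by
  have hΔ' : unitarityBound3D (ℓ - 1) < (ℓ : ℝ) + 2 := by
    unfold unitarityBound3D
    split_ifs with h
    · have : (0 : ℝ) ≤ ℓ := Nat.cast_nonneg ℓ
      linarith
    · rw [Nat.cast_sub hℓ]; push_cast; linarith
  have hz : (1 / 2 : ℝ) ∈ Ioo (0 : ℝ) 1 := ⟨by norm_num, by norm_num⟩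
  have hpos := hrBlock_pos hΔ' hz hz
  refine ⟨hrBlock ((ℓ : ℝ) + 1) ℓ,
    fun z zb => hrBlock ((ℓ : ℝ) + 1) ℓ z zb + 1 * hrBlock ((ℓ : ℝ) + 2) (ℓ - 1) z zb,
    isConformalBlock3DAbove_hrBlock_bound ℓ, isConformalBlock3DAbove_bound_add_smul hℓ 1,
    1 / 2, 1 / 2, hz, hz, ?_⟩
  intro h
  linarith

/-! ### 4. The exceptional set is exactly the non-uniqueness locus of the generic clause -/

/-- **Characterisation at admissible points (equal external dimensions).** At an admissible `(Δ₀, ℓ)` all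
solutions of the generic clause `IsConformalBlock3DAbove 0 0 Δ₀ ℓ` agree on the open square iff the point is
regular (`IsRegularPoint3D`: neither the bound nor an accidental degeneracy). Since the generic clause is
solvable at every admissible point (`IsAdmissible3D.isConformalBlock3DAbove_hrBlock`), the limit clause of
`IsConformalBlock3D` is used exactly where the generic clause fails to pin the block.
[cite: KosPolandSimmonsduffin2014, §4 eqs. (4.2)–(4.3)] -/
theorem IsAdmissible3D.eqOn_above_iff_isRegularPoint3D {Δ₀ : ℝ} {ℓ : ℕ} (hadm : IsAdmissible3D Δ₀ ℓ) :
    (∀ g₁ g₂ : ℝ → ℝ → ℝ, IsConformalBlock3DAbove 0 0 Δ₀ ℓ g₁ → IsConformalBlock3DAbove 0 0 Δ₀ ℓ g₂ →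
        ∀ z zb : ℝ, z ∈ Ioo (0 : ℝ) 1 → zb ∈ Ioo (0 : ℝ) 1 → g₁ z zb = g₂ z zb) ↔
      IsRegularPoint3D Δ₀ ℓ := by
  constructor
  · intro huniq
    refine ⟨fun heq => ?_, fun hacc => ?_⟩
    · -- at the bound: `ℓ ≥ 1`, `Δ₀ = ℓ + 1`, and the two solutions of `not_eqOn_above_bound` differ
      have hℓ : 1 ≤ ℓ := by
        by_contra h0
        have h0' : ℓ = 0 := by omega
        exact absurd heq.symm (hadm.2 h0').ne
      have hΔ : Δ₀ = (ℓ : ℝ) + 1 := by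
        rw [heq]; unfold unitarityBound3D; rw [if_neg (by omega)]
      subst hΔ
      obtain ⟨g₁, g₂, h₁, h₂, z, zb, hz, hzb, hne⟩ := not_eqOn_above_bound hℓ
      exact hne (huniq g₁ g₂ h₁ h₂ z zb hz hzb)
    · have hlt : unitarityBound3D ℓ < Δ₀ := by
        refine lt_of_le_of_ne hadm.1 (fun heq => ?_)
        -- at the bound there is no accidental degeneracy witness issue: reduce to the previous case
        have hℓ : 1 ≤ ℓ := by
          by_contra h0
          have h0' : ℓ = 0 := by omega
          exact absurd heq (hadm.2 h0').ne
        have hΔ : Δ₀ = (ℓ : ℝ) + 1 := by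
          rw [← heq]; unfold unitarityBound3D; rw [if_neg (by omega)]
        subst hΔ
        obtain ⟨g₁, g₂, h₁, h₂, z, zb, hz, hzb, hne⟩ := not_eqOn_above_bound hℓ
        exact hne (huniq g₁ g₂ h₁ h₂ z zb hz hzb)
      obtain ⟨g₁, g₂, h₁, h₂, z, zb, hz, hzb, hne⟩ := not_eqOn_above_of_accidental 0 0 hlt hacc
      exact hne (huniq g₁ g₂ h₁ h₂ z zb hz hzb)
  · rintro ⟨hne, hacc⟩ g₁ g₂ h₁ h₂
    exact h₁.eqOn_of_isRegular (lt_of_le_of_ne hadm.1 (Ne.symm hne)) hacc h₂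

/-- **The generic clause at an admissible point, summarised**: it is always solvable, and uniquely so iff
the point is regular. [cite: KosPolandSimmonsduffin2014, §4 eqs. (4.2)–(4.3)] -/
theorem IsAdmissible3D.generic_clause_summary {Δ₀ : ℝ} {ℓ : ℕ} (hadm : IsAdmissible3D Δ₀ ℓ) :
    (∃ g : ℝ → ℝ → ℝ, IsConformalBlock3DAbove 0 0 Δ₀ ℓ g) ∧
      ((∀ g₁ g₂ : ℝ → ℝ → ℝ, IsConformalBlock3DAbove 0 0 Δ₀ ℓ g₁ → IsConformalBlock3DAbove 0 0 Δ₀ ℓ g₂ →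
          ∀ z zb : ℝ, z ∈ Ioo (0 : ℝ) 1 → zb ∈ Ioo (0 : ℝ) 1 → g₁ z zb = g₂ z zb) ↔
        IsRegularPoint3D Δ₀ ℓ) :=
  ⟨⟨hrBlock Δ₀ ℓ, hadm.isConformalBlock3DAbove_hrBlock⟩, hadm.eqOn_above_iff_isRegularPoint3D⟩

end Literature.MathematicalPhysics.QuantumFieldTheory.ConformalBootstrap3D
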